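import Literature.AlgebraicGeometry.HodgeTheory.LimitMixedHodgeStructureSl2Triple
import HarnessLib

/-!
# The bigraded primitive parts `P^{a,b} = I^{a,b} ∩ ker N^{l+1}` of a polarized limit mixed Hodge structure:
# reality under the `ℝ`-splitting and the positivity `0 < i^{a−b} Q(v, N^l v̄)` (Balnojan–Hertling (3.8), Def. 3.3 (iv)(β))

Balnojan–Hertling, *Real Seifert forms and polarizing forms of Steenbrink mixed Hodge structures*, Bull. Braz. Math.
Soc. 50 (2019) (arXiv:1712.00383), Lemma 3.5 and Def. 3.3, VERBATIM (pp. 11–13 of the arXiv text):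

> "If `W = W^{(N,m)}` … define additionally for `p + q ≥ m`:
> `I_0^{p,q} := ker(N^{p+q−m+1} : I^{p,q} → I^{m−q−1,m−p−1})`.  Then (3.6) `N(I^{p,q}) ⊂ I^{p−1,q−1}`,
> (3.7) `I^{p,q} = ⊕_{j≥0} N^j I_0^{p+j,q+j}`, (3.8) `I_0^{q,p} ≅ conj I_0^{p,q} mod W_{p+q−2}`";
> Def. 3.3 (c)(iv)(β): "`i^{2p−m−l}·S_l(a, ā) > 0` for `a ∈ F^p P_{m+l} ∩ conj F^{m+l−p} P_{m+l} − {0}`",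
> `S_l(a, b) = S(ã, N^l b̃)` (Lemma 3.2 (c)); proof of Thm. 3.8: "`I^{qp} = conj I^{pq}` implies `I_0^{qp} = conj I_0^{pq}`
> … Choose `a ∈ (I_0^{p,q})_λ − {0}`.  The polarizing condition (c)(iv)(β) in definition 3.3 says
> `0 < i^{p−q}·S_l(a, ā) = i^{2p−m−l}·S(a, N^l ā)`."

THIS FILE, for the tree's `(Polarized)LimitMixedHodgeStructure V k = (W, F, N(, Q))` (weight `k = m`), with the
primitive bigraded pieces written `I^{a,b} ∩ ker N_ℂ^{l+1}` (`a + b = k + l`) exactly as in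
`LimitMixedHodgeStructureBigrading.lean` (which proves (3.6), (3.7)) and `LimitMixedHodgeStructureDeligneGrading.lean`
(which proves (3.10)):

* §1 **(3.8) in the `ℝ`-split case, on the nose: `conj (I^{a,b} ∩ ker N^{n}) = I^{b,a} ∩ ker N^{n}`**
  (`complexConj_deligneI_inf_ker_of_isSplitOverR`; `N` is real so `conj` commutes with `N_ℂ^n`,
  `conj_pow_N_baseChange_apply`), and the identification of `⊕_{a+b=k+l} P^{a,b}` with the primitive space
  `P_{−l}` of the Lefschetz module `(V_ℂ, −H, N_ℂ)` of `LimitMixedHodgeStructureSl2Triple.lean`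
  (`deligneI_inf_ker_le_primitiveSpace`).
* §2 **Def. 3.3 (iv)(β) ON VECTORS OF `V_ℂ`: for a polarized limit mixed Hodge structure, `a + b = k + l` and
  `0 ≠ v ∈ I^{a,b}` with `N^{l+1} v = 0`, the number `i^{a−b} · Q_ℂ(v, N_ℂ^l v̄)` is a positive real**
  (`pos_deligneI_of_pow_N_eq_zero`) — the structure field `pos` (positivity of `S_l` on `(P_{k+l})^{a,b}`, stated on
  `ℂ ⊗ P_{k+l}`) transported to `V_ℂ`: the class of `v` in `ℂ ⊗ Gr^W_{k+l}` lies in `(Gr^W_{k+l})^{a,b}`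
  (`I^{a,b} ⊆ hodgePreimage a b = grLift (Gr^{a,b})`, `MixedHodgeStructureSplitting`), it is primitive because
  `N^{l+1} v = 0` (flatness of `ℂ/ℚ`: `HodgeStructure.mem_baseChange_ker_iff`), it is non-zero because
  `I^{a,b} ∩ W_{a+b−1} = 0`, and `(S_l)_ℂ([v], [v̄]) = Q_ℂ(v, N^l v̄)` (`grForm_baseChange_grProj`).  No splitting
  hypothesis is needed for §2.

These are the two inputs (besides (3.7), (3.10) and the Weyl operator) of the positivity half of Cattani–El
Zein–Griffiths–Lê Thm. 7.5.13 (1) (`Q` polarizes `exp(iN)·F`; next row of this seat).  All proved, no `sorry`, no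
definition, no named fact (D-0026 net debt `0`).

## References

* [BalnojanHertling2018] S. Balnojan, C. Hertling, *Real Seifert forms and polarizing forms of Steenbrink mixed Hodge
  structures*, Bull. Braz. Math. Soc. (N.S.) 50 (2019) 233–274, arXiv:1712.00383: Lemma 3.2 (c), Def. 3.3 (c)(iv)(β),
  Lemma 3.5 (3.8), proof of Thm. 3.8 (p. 13).
* [CattaniElZeinGriffithsLe2014] E. Cattani et al. (eds.), *Hodge Theory*, Math. Notes 49 (2014), Def. 7.5.9 (4) and
  Thm. 7.5.13.
-/

noncomputable section

open scoped TensorProduct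

namespace Literature.AlgebraicGeometry.HodgeTheory

open Module Motives Motives.MixedHodgeStructure
open Motives.HodgeStructure (conj conj_conj complexConj mem_complexConj conj_baseChange complexConj_inf)
open Literature.Algebra.Lie (degreeSpace mem_degreeSpace_iff IsZGrading HasLefschetzProperty)
open Literature.Algebra.Lie.HasLefschetzProperty (primitiveSpace mem_primitiveSpace_iff)

universe u

variable {V : Type u} [AddCommGroup V] [Module ℚ V] {k : ℤ}

/-! ## §1 Reality of the bigraded primitive pieces under the `ℝ`-splitting; `P^{a,b} ⊆ P_{−l}` -/

namespace LimitMixedHodgeStructure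

variable (L : LimitMixedHodgeStructure V k)

/-- `conj (N_ℂ^n x) = N_ℂ^n (conj x)`: `N` is rational, hence real. [cite: BalnojanHertling2018, Lemma 3.5 (3.8)] -/
theorem conj_pow_N_baseChange_apply (n : ℕ) (x : ℂ ⊗[ℚ] V) :
    conj ((L.N ^ n).baseChange ℂ x) = (L.N ^ n).baseChange ℂ (conj x) :=
  conj_baseChange _ x

/-- `conj (ker N_ℂ^n) = ker N_ℂ^n`. [cite: BalnojanHertling2018, Lemma 3.5 (3.8)] -/
theorem complexConj_ker_pow_N_baseChange (n : ℕ) :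
    complexConj (LinearMap.ker ((L.N ^ n).baseChange ℂ)) = LinearMap.ker ((L.N ^ n).baseChange ℂ) := by
  ext x
  rw [mem_complexConj, LinearMap.mem_ker, LinearMap.mem_ker, ← conj_pow_N_baseChange_apply]
  constructor
  · intro h
    have h' := congr_arg conj h
    rwa [conj_conj, map_zero] at h'
  · intro h
    rw [h, map_zero]

/-- **(3.8), `ℝ`-split case: `conj (I^{a,b} ∩ ker N^n) = I^{b,a} ∩ ker N^n`** ("`I^{qp} = conj I^{pq}` implies
`I_0^{qp} = conj I_0^{pq}`"). [cite: BalnojanHertling2018, Lemma 3.5 (3.8) and proof of Thm. 3.8 (a)] -/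
theorem complexConj_deligneI_inf_ker_of_isSplitOverR (hsplit : L.toMixedHodgeStructure.IsSplitOverR) (a b : ℤ)
    (n : ℕ) :
    complexConj (L.toMixedHodgeStructure.deligneI a b ⊓ LinearMap.ker ((L.N ^ n).baseChange ℂ)) =
      L.toMixedHodgeStructure.deligneI b a ⊓ LinearMap.ker ((L.N ^ n).baseChange ℂ) := by
  rw [complexConj_inf, hsplit.complexConj_deligneI, complexConj_ker_pow_N_baseChange]

/-- `v ∈ I^{a,b}`, `N^n v = 0` ⟹ `v̄ ∈ I^{b,a}`, `N^n v̄ = 0` (split case). [cite: BalnojanHertling2018, proof of Thm. 3.8 (a)] -/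
theorem conj_mem_deligneI_inf_ker_of_isSplitOverR (hsplit : L.toMixedHodgeStructure.IsSplitOverR) {a b : ℤ}
    {n : ℕ} {v : ℂ ⊗[ℚ] V}
    (hv : v ∈ L.toMixedHodgeStructure.deligneI a b ⊓ LinearMap.ker ((L.N ^ n).baseChange ℂ)) :
    conj v ∈ L.toMixedHodgeStructure.deligneI b a ⊓ LinearMap.ker ((L.N ^ n).baseChange ℂ) := by
  rw [← L.complexConj_deligneI_inf_ker_of_isSplitOverR hsplit a b n, mem_complexConj, conj_conj]
  exact hv

variable [FiniteDimensional ℚ V]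

/-- **`P^{a,b} = I^{a,b} ∩ ker N^{l+1} ⊆ P_{−l}`**, the primitive space (`= M_{−l} ∩ ker e^{l+1}`) of the Lefschetz module
`(V_ℂ, −H, N_ℂ)` (`a + b = k + l`; `I^{a,b} ⊆ E_{−l}(−H)`). [cite: CattaniElZeinGriffithsLe2014, §7.5 (7.5.13) and App. A (A.3.5)] -/
theorem deligneI_inf_ker_le_primitiveSpace (l : ℕ) {a b : ℤ} (hab : a + b = k + l) :
    L.toMixedHodgeStructure.deligneI a b ⊓ LinearMap.ker ((L.N ^ (l + 1)).baseChange ℂ) ≤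
      primitiveSpace (-L.deligneH) (L.N.baseChange ℂ) l := by
  intro x hx
  obtain ⟨hxI, hxN⟩ := Submodule.mem_inf.1 hx
  rw [mem_primitiveSpace_iff]
  refine ⟨?_, ?_⟩
  · have h := L.deligneI_le_degreeSpace a b hxI
    rwa [show k - (a + b) = -(l : ℤ) by omega] at h
  · rw [LinearMap.mem_ker, LinearMap.baseChange_pow] at hxN
    exact hxN

end LimitMixedHodgeStructure

/-! ## §2 Def. 3.3 (iv)(β) on vectors of `V_ℂ`: `0 < i^{a−b} Q_ℂ(v, N^l v̄)` for `0 ≠ v ∈ P^{a,b}` -/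

namespace PolarizedLimitMixedHodgeStructure

variable [FiniteDimensional ℚ V] (L : PolarizedLimitMixedHodgeStructure V k)

/-- **Positivity (iv)(β) transported to `V_ℂ`**: for `a + b = k + l`, `0 ≠ v ∈ I^{a,b}` with `N^{l+1} v = 0`
(i.e. `v ∈ P^{a,b} = I_0^{a,b}`), **`i^{a−b} · Q_ℂ(v, N_ℂ^l v̄)` is a positive real number** ("the polarizing
condition (c)(iv)(β) … says `0 < i^{p−q}·S_l(a, ā) = i^{2p−m−l}·S(a, N^l ā)`"; in the tree's convention
`i^{a}(i^{b})⁻¹`).  Proof: the class `[v] ∈ ℂ ⊗ Gr^W_{k+l}` lies in the piece `(Gr^W_{k+l})^{a,b}` and in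
`ℂ ⊗ P_{k+l}`, is non-zero, and `(S_l)_ℂ([v], [v̄]) = Q_ℂ(v, N^l v̄)`; apply the axiom `pos`.
[cite: BalnojanHertling2018, Def. 3.3 (c)(iv)(β) and proof of Thm. 3.8 (b) (p. 13)] [cite: CattaniElZeinGriffithsLe2014, Def. 7.5.9 (4)] -/
theorem pos_deligneI_of_pow_N_eq_zero {l : ℕ} {a b : ℤ} (hab : a + b = k + l) {v : ℂ ⊗[ℚ] V}
    (hvI : v ∈ L.toMixedHodgeStructure.deligneI a b) (hvN : (L.N ^ (l + 1)).baseChange ℂ v = 0) (hv0 : v ≠ 0) :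
    ∃ r : ℝ, 0 < r ∧
      Complex.I ^ a * (Complex.I ^ b)⁻¹ * L.Q.baseChange ℂ v ((L.N ^ l).baseChange ℂ (conj v)) = r := by
  obtain rfl : b = k + l - a := by omega
  set H := L.toMixedHodgeStructure with hH
  -- Step 1: a representative `ṽ ∈ ℂ ⊗ W_{k+l}` whose class lies in `(Gr^W_{k+l})^{a, k+l-a}`
  have h1 : v ∈ H.grLift (k + l) ((H.gr (k + l)).piece a (k + l - a)) := by
    rw [H.grLift_piece]
    exact H.deligneI_le_hodgePreimage a (k + l - a) hvI
  obtain ⟨vt, hvt, hvtv⟩ := Submodule.mem_map.1 h1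
  replace hvt := Submodule.mem_comap.1 hvt
  -- Step 2: the class `y = π ṽ` is killed by `Gr(N^{l+1})_ℂ`, hence lies in `ℂ ⊗ P_{k+l}`
  set g := (L.toLimitMixedHodgeStructure.powNHom (l + 1)).grMap (k + l) with hg
  have hres : ((L.toLimitMixedHodgeStructure.powNHom (l + 1)).restrictW (k + l)).baseChange ℂ vt = 0 := by
    apply grIncl_injective _ (k + l)
    have hc := LinearMap.congr_fun
      (Hom.grIncl_comp_restrictW_baseChange (L.toLimitMixedHodgeStructure.powNHom (l + 1)) (k + l)) vt
    rw [LinearMap.comp_apply, LinearMap.comp_apply, LimitMixedHodgeStructure.powNHom_toLinearMap] at hc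
    rw [hc, map_zero]
    show (L.N ^ (l + 1)).baseChange ℂ (grIncl H.W (k + l) vt) = 0
    rw [hvtv, hvN]
  have hgy : g.baseChange ℂ (grProj H.W (k + l) vt) = 0 := by
    have hc := LinearMap.congr_fun
      (Hom.grMap_baseChange_comp_grProj (L.toLimitMixedHodgeStructure.powNHom (l + 1)) (k + l)) vt
    rw [LinearMap.comp_apply, LinearMap.comp_apply] at hc
    rw [hg, hc, hres, map_zero]
  have hy : grProj H.W (k + l) vt ∈ (L.prim l).toSubmodule.baseChange ℂ :=
    (HodgeStructure.mem_baseChange_ker_iff g _).2 hgy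
  -- `x : ℂ ⊗ P_{k+l}` with `ι x = π ṽ`
  obtain ⟨x, hx'⟩ : ∃ x : ℂ ⊗[ℚ] ↥(L.prim l).toSubmodule,
      (L.prim l).toSubmodule.subtype.baseChange ℂ x = grProj H.W (k + l) vt := hy
  -- Step 3: `x` lies in the piece `(P_{k+l})^{a, k+l-a}`
  have hxpiece : x ∈ (L.prim l).toHodgeStructure.piece a (k + l - a) := by
    rw [HodgeStructure.SubHodgeStructure.mem_piece_iff, hx']
    exact hvt
  -- Step 4: `x ≠ 0` (else `v ∈ W_{k+l-1}`, but `I^{a,b} ∩ W_{a+b-1} = 0`)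
  have hx0 : x ≠ 0 := by
    intro hx0
    apply hv0
    have hker : vt ∈ LinearMap.ker (grProj H.W (k + l)) := by
      rw [LinearMap.mem_ker, ← hx', hx0, map_zero]
    have hvW : v ∈ (H.W (k + l) ⊓ H.W (k + l - 1)).baseChange ℂ := by
      rw [← map_grIncl_ker_grProj, ← hvtv]
      exact ⟨vt, hker, rfl⟩
    have hvW' : v ∈ (H.W (a + (k + l - a) - 1)).baseChange ℂ := by
      rw [show a + (k + l - a) - 1 = k + l - 1 by ring]
      exact Submodule.baseChange_mono (A := ℂ) inf_le_right hvW
    have h0 : v ∈ H.deligneI a (k + l - a) ⊓ (H.W (a + (k + l - a) - 1)).baseChange ℂ := ⟨hvI, hvW'⟩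
    rwa [H.deligneI_inf_W_pred_eq_bot, Submodule.mem_bot] at h0
  -- Step 5: the axiom `pos` and `(S_l)_ℂ([v], [v̄]) = Q_ℂ(v, N^l v̄)`
  obtain ⟨r, hr, hval⟩ := L.pos l a (k + l - a) (by ring) x hxpiece hx0
  refine ⟨r, hr, ?_⟩
  have hform : (L.primForm l).baseChange ℂ x (conj x) = L.Q.baseChange ℂ v ((L.N ^ l).baseChange ℂ (conj v)) := by
    rw [LimitMixedHodgeStructure.primForm_baseChange_apply, ← conj_baseChange (L.prim l).toSubmodule.subtype x, hx',
      conj_baseChange (subPiece H.W (k + l)).mkQ vt,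
      L.isMonodromyWeightFiltration.grForm_baseChange_grProj L.nondegenerate_Q L.skew_N l vt (conj vt),
      ← conj_baseChange (H.W (k + l)).subtype vt]
    show L.Q.baseChange ℂ (grIncl H.W (k + l) vt) ((L.N ^ l).baseChange ℂ (conj (grIncl H.W (k + l) vt))) = _
    rw [hvtv]
  rw [← hval, hform]

/-- The same with the primitive piece written as in `LimitMixedHodgeStructureBigrading` (`I^{a,b} ∩ ker N_ℂ^{l+1}` with
the power of the base change). [cite: BalnojanHertling2018, Def. 3.3 (c)(iv)(β)] -/
theorem pos_of_mem_deligneI_inf_ker {l : ℕ} {a b : ℤ} (hab : a + b = k + l) {v : ℂ ⊗[ℚ] V}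
    (hv : v ∈ L.toMixedHodgeStructure.deligneI a b ⊓ LinearMap.ker (L.N.baseChange ℂ ^ (l + 1))) (hv0 : v ≠ 0) :
    ∃ r : ℝ, 0 < r ∧
      Complex.I ^ a * (Complex.I ^ b)⁻¹ * L.Q.baseChange ℂ v ((L.N.baseChange ℂ ^ l) (conj v)) = r := by
  rw [← LinearMap.baseChange_pow]
  refine L.pos_deligneI_of_pow_N_eq_zero hab hv.1 ?_ hv0
  rw [LinearMap.baseChange_pow]
  exact hv.2

/-- In particular `Q_ℂ(v, N_ℂ^l v̄) ≠ 0` for `0 ≠ v ∈ P^{a,b}` (`N^l : P^{a,b} → I^{b−l…}` is injective and the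
pairing with `v̄` detects it). [cite: BalnojanHertling2018, Def. 3.3 (c)(iv)(β)] -/
theorem Q_baseChange_pow_N_conj_ne_zero {l : ℕ} {a b : ℤ} (hab : a + b = k + l) {v : ℂ ⊗[ℚ] V}
    (hvI : v ∈ L.toMixedHodgeStructure.deligneI a b) (hvN : (L.N ^ (l + 1)).baseChange ℂ v = 0) (hv0 : v ≠ 0) :
    L.Q.baseChange ℂ v ((L.N ^ l).baseChange ℂ (conj v)) ≠ 0 := by
  obtain ⟨r, hr, h⟩ := L.pos_deligneI_of_pow_N_eq_zero hab hvI hvN hv0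
  intro h0
  rw [h0, mul_zero] at h
  exact hr.ne' (by exact_mod_cast h.symm)

end PolarizedLimitMixedHodgeStructure

end Literature.AlgebraicGeometry.HodgeTheory
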